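import Summits.PneNP.PneNP.Theses.SzkEntropy
import Summits.PneNP.PneNP.Theorems.SzkEntropyPeaThreeNotInPKillSwitch
import Summits.PneNP.PneNP.Theorems.SzkEntropyPeaDegreeReduction
import Literature.Computability.Complexity.PolynomialEntropyApproximation
import Literature.Computability.Complexity.PromiseBPPClosureProofs
import Literature.Computability.Complexity.PromiseZPPProofs
import Literature.Computability.Complexity.PEASigmaTwo
import Literature.Computability.Complexity.EquivalenceProblemsCollapseProofs
import Literature.Computability.Complexity.PromiseAdleman

/-!
# PneNP / SzkEntropy — the kill switch `PeaThreeMemBPP` (stmt-PneNP-10781): calibration from both sides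

Route `PneNP/SzkEntropy`, support item stmt-PneNP-10781 (`PeaThreeMemBPP`, the route's NEGATIVE SIDE /
kill switch):

  `PEA 3 ∈ PromiseBPP'` — entropy approximation with additive gap one bit for sparse CUBIC maps over
  `F₂` is in textbook promise-`BPP`.

By Dvir–Gutfreund–Rothblum–Vadhan (Thm 1.1 / Thm 4.7) this is `SZKP_L ⊆ prBPP` (Graph Isomorphism,
Quadratic Residuosity, DLOG/DDH-type problems and `GapCVP_√n` in `BPP`); it is OPEN in print in both
directions and this file does not settle it.  What it records, as SUPPORT lemmas of the item and over
PROVED tree theorems only, is exactly how strong each direction is inside the tree: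

* `szkEntropy_peaThreeMemBPP_iff_forall` — **the kill switch is degree-free**: by the proved degree
  reduction `PEA_d ≤ₚ PEA_3` (`szkEntropy_peaDegreeReduction_proof`, AIK randomizing polynomials) and the
  proved closure of promise-`BPP` under Karp reductions (`mem_PromiseBPP'_of_polyTimeReducible_holds'`),
  `PeaThreeMemBPP ↔ ∀ d, PEA d ∈ PromiseBPP'`: entropy approximation of EVERY sparse polynomial map over
  `F₂` would be in `prBPP`.  Dually `¬ PeaThreeMemBPP ↔ ∀ d ≥ 3, PEA d ∉ PromiseBPP'`
  (`szkEntropy_not_peaThreeMemBPP_iff_forall_ge`), and the set of easy degrees is an initial segment: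
  either all of `ℕ` or contained in `{0, 1, 2}` (`szkEntropy_PEA_mem_PromiseBPP'_imp_le_two`).
* `szkEntropy_peaThreeMemBPP_of_SigmaP_two_subset_BPP` / `…_of_NP_subset_BPP` — **the kill switch
  follows from `Σ₂ᵖ ⊆ BPP`, hence from `NP ⊆ BPP`**: `PEA_3 ∈ promiseLift Σ₂ᵖ` is the proved tree theorem
  `PEAHash.PEA_mem_promiseLift_SigmaP_two` (Sipser hashing), `promiseLift BPP = PromiseBPP ⊆ PromiseBPP'`
  (`PromiseBPP_subset_PromiseBPP'_holds`), and `NP ⊆ BPP → Σ₂ᵖ ⊆ BPP` is Zachos' collapse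
  (`SigmaP_subset_BPP_of_NP_subset_BPP`).  Contrapositively **refuting the kill switch proves
  `NP ⊄ BPP`** (`szkEntropy_NP_not_subset_BPP_of_not_peaThreeMemBPP`), a statement stronger than
  `P ≠ NP`;
* `szkEntropy_pneNP_of_not_peaThreeMemBPP` — and indeed **`¬ PeaThreeMemBPP → PneNP` outright**: the
  negation gives thesis X (`szkEntropy_peaThreeNotInP_of_not_peaThreeMemBPP`) and the three other
  hypotheses of the route's certified deciding theorem `closes` are now linked in the route file
  (`PeaMemPH_holds`, `PhCollapse_holds`, `CookModelBridge_holds`); so `PneNP ∨ PeaThreeMemBPP`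
  (`szkEntropy_pneNP_or_peaThreeMemBPP`);
* `szkEntropy_PEA_mem_promiseLift_PPoly_of_peaThreeMemBPP` /
  `szkEntropy_not_peaThreeMemBPP_of_PEA_not_mem_promiseLift_PPoly` — **the nonuniform side**: by
  Adleman's theorem for promise problems (`PromiseBPP' ⊆ promiseLift PPoly`, `PromiseAdleman.lean`)
  the kill switch gives every `PEA_d` a polynomial-size family of separating circuits, so a circuit
  lower bound for entropy approximation in any one degree refutes it (and then proves the summit,
  `szkEntropy_pneNP_of_PEA_not_mem_promiseLift_PPoly`).

So the item is pinned between `NP ⊆ BPP` (which implies it) and `PneNP` (which its negation implies):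
neither a proof (an `SZKP_L ⊆ prBPP` algorithm) nor a refutation (a randomized or nonuniform lower bound
that would settle the summit) is available, which is the precise sense in which the kill switch is
"open both ways".

References: Z. Dvir, D. Gutfreund, G. N. Rothblum, S. Vadhan, *On approximating the entropy of
polynomial mappings*, ICS 2011 (ECCC TR10-160), Thm 1.1, §4.4, Thm 4.5; O. Goldreich, *On promise
problems* (2006), §1.2 (Def. 2, Def. 3 and the remark p. 258); S. Zachos, JCSS 36 (1988) (as used in
Fortnow–Grochow 2011, Cor. 4.4); M. Sipser, STOC 1983, §V; L. Adleman, FOCS 1978 (Arora–Barak 2009,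
Thm. 7.14).
-/

namespace Summit.PneNP.PneNP.Theorems

open Literature.Computability.Complexity
open Summit.PneNP.PneNP.Theses.SzkEntropy

/-! ### The kill switch is degree-free -/

/-- **The kill switch is degree-free**: `PeaThreeMemBPP ↔ ∀ d, PEA d ∈ PromiseBPP'`.  Upward by the
PROVED degree reduction `PEA_d ≤ₚ PEA_3` (`szkEntropy_peaDegreeReduction_proof`: perfect degree-3
randomizing polynomials) and the proved closure of textbook promise-`BPP` under Karp reductions of
promise problems (`PromiseProblem.mem_PromiseBPP'_of_polyTimeReducible_holds'`); downward at `d = 3`.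
So the item says that entropy approximation of EVERY sparse polynomial map over `F₂` is in `prBPP`.
[DvirGutfreundRothblumVadhan2010, Thm 4.5 and §4.4; Goldreich2006, §1.2 (remark after Def. 3)] -/
theorem szkEntropy_peaThreeMemBPP_iff_forall : PeaThreeMemBPP ↔ ∀ d : ℕ, PEA d ∈ PromiseBPP' := by
  rw [szkEntropy_peaThreeMemBPP_iff]
  refine ⟨fun h3 d => ?_, fun h => h 3⟩
  exact PromiseProblem.mem_PromiseBPP'_of_polyTimeReducible_holds'
    (szkEntropy_peaDegreeReduction_iff.1 szkEntropy_peaDegreeReduction_proof d) h3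

/-- **Any single degree `d ≥ 3` carries the kill switch**: `PeaThreeMemBPP ↔ PEA d ∈ PromiseBPP'` for
each `d ≥ 3` (all degrees `≥ 3` are inter-reducible: identity upward, degree reduction downward).
[DvirGutfreundRothblumVadhan2010, Thm 4.5 and Claim 4.4] -/
theorem szkEntropy_peaThreeMemBPP_iff_of_three_le {d : ℕ} (hd : 3 ≤ d) :
    PeaThreeMemBPP ↔ PEA d ∈ PromiseBPP' :=
  ⟨fun h => szkEntropy_peaThreeMemBPP_iff_forall.1 h d, fun h =>
    szkEntropy_peaThreeMemBPP_iff.2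
      (PromiseProblem.mem_PromiseBPP'_of_polyTimeReducible_holds' (PEA_polyTimeReducible_of_le hd) h)⟩

/-- **The kill switch from one high degree**: `PeaThreeMemBPP ↔ ∃ d ≥ 3, PEA d ∈ PromiseBPP'`.
[DvirGutfreundRothblumVadhan2010, Thm 4.5] -/
theorem szkEntropy_peaThreeMemBPP_iff_exists_ge :
    PeaThreeMemBPP ↔ ∃ d : ℕ, 3 ≤ d ∧ PEA d ∈ PromiseBPP' :=
  ⟨fun h => ⟨3, le_rfl, szkEntropy_peaThreeMemBPP_iff.1 h⟩,
    fun ⟨_, hd, h⟩ => (szkEntropy_peaThreeMemBPP_iff_of_three_le hd).2 h⟩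

/-- **Refuting the kill switch is a lower bound in every degree `≥ 3` at once**:
`¬ PeaThreeMemBPP ↔ ∀ d ≥ 3, PEA d ∉ PromiseBPP'`. [DvirGutfreundRothblumVadhan2010, Thm 4.5 and §4.4] -/
theorem szkEntropy_not_peaThreeMemBPP_iff_forall_ge :
    ¬ PeaThreeMemBPP ↔ ∀ d : ℕ, 3 ≤ d → PEA d ∉ PromiseBPP' := by
  rw [szkEntropy_peaThreeMemBPP_iff_exists_ge]
  push Not
  rfl

/-- **The easy degrees form an initial segment: all of `ℕ`, or inside `{0, 1, 2}`.** If the kill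
switch fails, every degree `d` with `PEA d ∈ PromiseBPP'` is `≤ 2` — the route's degree dial (`d = 1`
matrix rank, `d = 2` the crux `PeaTwoMemBPP`) is then the whole story.
[DvirGutfreundRothblumVadhan2010, §1 p. 1 and Thm 4.5] -/
theorem szkEntropy_PEA_mem_PromiseBPP'_imp_le_two (hK : ¬ PeaThreeMemBPP) {d : ℕ}
    (hd : PEA d ∈ PromiseBPP') : d ≤ 2 := by
  by_contra hlt
  exact (szkEntropy_not_peaThreeMemBPP_iff_forall_ge.1 hK) d (by omega) hd

/-! ### The kill switch follows from `NP ⊆ BPP` -/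

/-- **`Σ₂ᵖ ⊆ BPP` implies the kill switch**: `PEA_3 ∈ promiseLift Σ₂ᵖ` (the proved tree theorem
`PEAHash.PEA_mem_promiseLift_SigmaP_two`, Sipser hashing for approximate fibre counting), `promiseLift`
is monotone, and `promiseLift BPP = PromiseBPP ⊆ PromiseBPP'` (`PromiseBPP_subset_PromiseBPP'_holds`).
[Sipser1983, §V; DvirGutfreundRothblumVadhan2010, §3; Goldreich2006, §1.2 (Def. 2)] -/
theorem szkEntropy_peaThreeMemBPP_of_SigmaP_two_subset_BPP (h : SigmaP 2 ⊆ BPP) : PeaThreeMemBPP :=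
  szkEntropy_peaThreeMemBPP_iff.2
    (PromiseBPP_subset_PromiseBPP'_holds (promiseLift_mono h (PEAHash.PEA_mem_promiseLift_SigmaP_two 3)))

/-- **`NP ⊆ BPP` implies the kill switch**, through Zachos' collapse `NP ⊆ BPP → Σ₂ᵖ ⊆ BPP`
(`SigmaP_subset_BPP_of_NP_subset_BPP`). [FortnowGrochow2011, Cor. 4.4 (proof, "PH ⊆ BPP [Zachos]");
DvirGutfreundRothblumVadhan2010, §4.4] -/
theorem szkEntropy_peaThreeMemBPP_of_NP_subset_BPP (h : Nondeterministic.NP ⊆ BPP) : PeaThreeMemBPP :=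
  szkEntropy_peaThreeMemBPP_of_SigmaP_two_subset_BPP (SigmaP_subset_BPP_of_NP_subset_BPP h 2)

/-- **Refuting the kill switch separates `Σ₂ᵖ` from `BPP`**: `¬ PeaThreeMemBPP → ¬ (Σ₂ᵖ ⊆ BPP)`.
[Sipser1983, §V; DvirGutfreundRothblumVadhan2010, Thm 1.1] -/
theorem szkEntropy_SigmaP_two_not_subset_BPP_of_not_peaThreeMemBPP (hK : ¬ PeaThreeMemBPP) :
    ¬ (SigmaP 2 ⊆ BPP) :=
  fun h => hK (szkEntropy_peaThreeMemBPP_of_SigmaP_two_subset_BPP h)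

/-- **Refuting the kill switch proves `NP ⊄ BPP`** (stronger than `P ≠ NP`):
`¬ PeaThreeMemBPP → ¬ (NP ⊆ BPP)`.  This is the formal reason the negative side of the route cannot be
discharged by any currently available lower-bound technique. [FortnowGrochow2011, Cor. 4.4 (proof);
DvirGutfreundRothblumVadhan2010, Thm 1.1] -/
theorem szkEntropy_NP_not_subset_BPP_of_not_peaThreeMemBPP (hK : ¬ PeaThreeMemBPP) :
    ¬ (Nondeterministic.NP ⊆ BPP) :=
  fun h => hK (szkEntropy_peaThreeMemBPP_of_NP_subset_BPP h)

/-- **The dichotomy**: `PeaThreeMemBPP ∨ ¬ (NP ⊆ BPP)` holds outright — either cubic entropy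
approximation is in `prBPP`, or `NP ⊄ BPP`. [DvirGutfreundRothblumVadhan2010, Thm 1.1;
FortnowGrochow2011, Cor. 4.4] -/
theorem szkEntropy_peaThreeMemBPP_or_NP_not_subset_BPP :
    PeaThreeMemBPP ∨ ¬ (Nondeterministic.NP ⊆ BPP) := by
  by_cases h : PeaThreeMemBPP
  · exact Or.inl h
  · exact Or.inr (szkEntropy_NP_not_subset_BPP_of_not_peaThreeMemBPP h)

/-! ### Refuting the kill switch settles the summit -/

/-- **`¬ PeaThreeMemBPP → PneNP`, unconditionally.** The negation of the kill switch gives thesis X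
(`szkEntropy_peaThreeNotInP_of_not_peaThreeMemBPP`, as `PromiseP ⊆ PromiseBPP'`), and the remaining
hypotheses of the route's certified deciding theorem `closes` are the linked tree theorems
`PeaMemPH_holds` (`PEA_d ∈ promise-PH`), `PhCollapse_holds` (`NP ⊆ P → PH ⊆ P`) and
`CookModelBridge_holds` (Cook's model = the tree's classes).  Hence a refutation of this item IS a
proof of the summit. [DvirGutfreundRothblumVadhan2010, Thm 1.1 and Lemma 4.9; AroraBarakCC2009, Thm 5.4] -/
theorem szkEntropy_pneNP_of_not_peaThreeMemBPP (hK : ¬ PeaThreeMemBPP) : _root_.PneNP :=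
  closes (szkEntropy_peaThreeNotInP_of_not_peaThreeMemBPP hK) PeaMemPH_holds PhCollapse_holds
    CookModelBridge_holds

/-- **Equivalently: if the summit statement fails, the kill switch holds** (`¬ PneNP → PeaThreeMemBPP`):
in a world with `P = NP` cubic entropy approximation is of course in `prBPP` — formally, through the
route's own deciding theorem rather than through an algorithm. [DvirGutfreundRothblumVadhan2010, Thm 1.1] -/
theorem szkEntropy_peaThreeMemBPP_of_not_pneNP (h : ¬ _root_.PneNP) : PeaThreeMemBPP := by
  by_contra hK
  exact h (szkEntropy_pneNP_of_not_peaThreeMemBPP hK)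

/-! ### The kill switch gives polynomial-size circuits (promise Adleman) -/

/-- **Under the kill switch every `PEA_d` has polynomial-size separating circuits**:
`PeaThreeMemBPP → ∀ d, PEA d ∈ promiseLift PPoly`, by Adleman's theorem for promise problems
(`PromiseBPP' ⊆ promiseLift PPoly`, `PromiseAdleman.lean`) applied degree by degree
(`szkEntropy_peaThreeMemBPP_iff_forall`). [Adleman1978; AroraBarakCC2009, Thm. 7.14;
DvirGutfreundRothblumVadhan2010, §4.4] -/
theorem szkEntropy_PEA_mem_promiseLift_PPoly_of_peaThreeMemBPP (hK : PeaThreeMemBPP) (d : ℕ) :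
    PEA d ∈ promiseLift PPoly :=
  PromiseBPP'_subset_promiseLift_PPoly (szkEntropy_peaThreeMemBPP_iff_forall.1 hK d)

/-- **A polynomial-size circuit lower bound for entropy approximation in ANY degree refutes the
kill switch**: if for some `d` no language with polynomial-size `B₂`-circuits separates `PEA_d`
(`PEA d ∉ promiseLift PPoly`), then `¬ PeaThreeMemBPP` — the nonuniform route to the negative side
(and then, by `szkEntropy_pneNP_of_not_peaThreeMemBPP`, to the summit). [Adleman1978;
AroraBarakCC2009, Thm. 7.14; DvirGutfreundRothblumVadhan2010, Thm 1.1] -/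
theorem szkEntropy_not_peaThreeMemBPP_of_PEA_not_mem_promiseLift_PPoly {d : ℕ}
    (h : PEA d ∉ promiseLift PPoly) : ¬ PeaThreeMemBPP :=
  fun hK => h (szkEntropy_PEA_mem_promiseLift_PPoly_of_peaThreeMemBPP hK d)

/-- **Circuit lower bounds for cubic entropy approximation settle the summit**:
`PEA d ∉ promiseLift PPoly → PneNP` for any `d` (previous lemma and
`szkEntropy_pneNP_of_not_peaThreeMemBPP`). [Adleman1978; DvirGutfreundRothblumVadhan2010, Thm 1.1] -/
theorem szkEntropy_pneNP_of_PEA_not_mem_promiseLift_PPoly {d : ℕ} (h : PEA d ∉ promiseLift PPoly) :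
    _root_.PneNP :=
  szkEntropy_pneNP_of_not_peaThreeMemBPP (szkEntropy_not_peaThreeMemBPP_of_PEA_not_mem_promiseLift_PPoly h)

/-- **The summit or the kill switch**: `PneNP ∨ PeaThreeMemBPP` holds outright — at least one of the
summit statement and the route's kill switch is TRUE (classical case split on `PneNP` with
`szkEntropy_peaThreeMemBPP_of_not_pneNP`).  Together with `PeaThreeNotInP ∨ PeaThreeMemBPP`
(`szkEntropy_peaThreeNotInP_or_peaThreeMemBPP`): a false kill switch gives X and the summit at once.
[DvirGutfreundRothblumVadhan2010, Thm 1.1] -/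
theorem szkEntropy_pneNP_or_peaThreeMemBPP : _root_.PneNP ∨ PeaThreeMemBPP := by
  by_cases h : _root_.PneNP
  · exact Or.inl h
  · exact Or.inr (szkEntropy_peaThreeMemBPP_of_not_pneNP h)

end Summit.PneNP.PneNP.Theorems
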